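import Mathlib
import HarnessLib
import Summits.MatrixMultiplication.MatrixMultiplication.Theses.OutsiderSandwich
import Literature.Computability.AlgebraicComplexity.AsymptoticRankMatMul
import Literature.Computability.AlgebraicComplexity.AsymptoticSpectrumDuality
import Literature.Barriers.MatrixMultiplication.UniversalMethodBarrierAsymptoticRank
import Literature.Barriers.MatrixMultiplication.RectangularBarrier

/-!
# OutsiderSandwich — CAPACITY VIA RANK: the registered stub `stub_capacityViaRank` of the residual

Route `OutsiderSandwich` (decomp-mm lens 4 «minimal counterexample / extremal reduction», gen 32).
The residual of record `LaserMergeOptimal` (BOTTOM, item stmt-MatrixMultiplication-27897) carries a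
REGISTERED skeleton (lens-4 gen 4, skeleton_sha b10ce633…) with two stubs:

* `stub_capacityViaRank : ∀ N m, ⟨m,m,m⟩ ≤ cw₂^{⊠N} → m^ω ≤ R̃(cw₂)^N` — PROVED HERE, by name and
  with the registered signature;
* `stub_rankCharge : R̃(cw₂) ≤ 3 · 2^{(ω−2)/3}` — open (it is at least summit-hard: with `ω = 2` it
  reads `R̃(cw₂) = 3`, the asymptotic-rank conjecture for `cw₂`; its implication
  `stub_rankCharge → LaserMergeOptimal` is the tree's
  `OutsiderSandwichSlopeDialExchange.laserMergeOptimal_of_asymptoticRank_le`, gen 31).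

## Content

* `stub_capacityViaRank` — the CAPACITY LAW of the `cw₂`-tower through the asymptotic rank:
  a matrix product `⟨m,m,m⟩` inside `cw₂^{⊠N}` (restriction) has
  `m^ω ≤ R̃(⟨m,m,m⟩) ≤ R̃(cw₂^{⊠N}) ≤ R̃(cw₂)^N`; ingredients, all tree theorems:
  `rpow_omega_le_asymptoticRank_matMulTensor` (`q^ω ≤ R̃⟨q,q,q⟩`, ADVXXZ §3.4),
  `asymptoticRank_le_of_polyDegeneratesTo` (monotonicity), `asymptoticRank_kroneckerPow_le`
  (`R̃(t^{⊠k}) ≤ R̃(t)^k`), `asymptoticRank_kroneckerPow_zero_le` (the empty power).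
* `capacityViaRank_of_algDegeneratesTo` — the same law for DEGENERATIONS `⟨m,m,m⟩ ⊴ cw₂^{⊠N}`
  (BCS (15.19)), which is the currency of the cell's finite census cells `D(N,m)` (a universal
  spectral point attaining `R̃⟨m,m,m⟩` is degeneration-monotone, Strassen duality).
* `rate_le_of_restrictsTo` / `rate_le_of_algDegeneratesTo` — the law in RATE form: every finite cell
  `⟨m,m,m⟩ ⊴ cw₂^{⊠N}`, `N ≥ 1`, has `m² ≤ (R̃(cw₂)^{2/ω})^N`, i.e. TOP's rate `m^{2/N}` is capped by
  `R̃(cw₂)^{2/ω}` uniformly in `N` (with the tree's `R̃(cw₂) ≤ 4`: rate `≤ 4^{2/ω}`).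

## References

* V. Strassen, *The asymptotic spectrum of tensors*, J. reine angew. Math. 384 (1988), §1, §3,
  Thm. 3.8. [Strassen1988]
* M. Christandl, P. Vrana, J. Zuiddam, *Universal points in the asymptotic spectrum of tensors*,
  J. AMS 36 (2023), §1.1, Prop. 1.6. [ChristandlVranaZuiddam2023]
* J. Alman, R. Duan, V. Vassilevska Williams, Y. Xu, Z. Xu, R. Zhou, *More asymmetry yields faster
  matrix multiplication*, SODA 2025, §3.4. [AlmanDuanVassilevskaWilliamsXuXuZhou2025]
* P. Bürgisser, M. Clausen, M. A. Shokrollahi, *Algebraic Complexity Theory* (1997), (15.19).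
  [BurgisserClausenShokrollahi1997]
-/

noncomputable section

open Literature.Computability.AlgebraicComplexity

namespace Summit.MatrixMultiplication.MatrixMultiplication.Theorems.OutsiderSandwichCapacityViaRank

/-- `R̃(cw₂^{⊠N}) ≤ R̃(cw₂)^N` for every `N` (including the empty power). [cite: ChristandlVranaZuiddam2023, §1.1] -/
theorem asymptoticRank_cwTwoPow_le (N : ℕ) :
    asymptoticRank (kroneckerPow (cwTensor ℂ 2) N) ≤ asymptoticRank (cwTensor ℂ 2) ^ N := by
  rcases Nat.eq_zero_or_pos N with rfl | hN
  · simpa using Literature.Barriers.MatrixMultiplication.asymptoticRank_kroneckerPow_zero_le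
      (cwTensor ℂ 2)
  · exact Literature.Barriers.MatrixMultiplication.asymptoticRank_kroneckerPow_le _ hN

/-- **CAPACITY VIA RANK — the registered stub `stub_capacityViaRank` of item 27897, by name:**
a matrix product inside `cw₂^{⊠N}` has `m^ω = R̃(⟨m,m,m⟩) ≤ R̃(cw₂^{⊠N}) ≤ R̃(cw₂)^N`.
[cite: Strassen1988, §1; ChristandlVranaZuiddam2023, §1.1] -/
theorem stub_capacityViaRank : ∀ N m : ℕ,
    TensorRestrictsTo (kroneckerPow (cwTensor ℂ 2) N) (matMulTensor ℂ m m m) →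
    (m : ℝ) ^ omega ℂ ≤ asymptoticRank (cwTensor ℂ 2) ^ N := by
  intro N m h
  have h1 : (m : ℝ) ^ omega ℂ ≤ asymptoticRank (matMulTensor ℂ m m m) :=
    rpow_omega_le_asymptoticRank_matMulTensor ℂ m
  have h2 : asymptoticRank (matMulTensor ℂ m m m) ≤
      asymptoticRank (kroneckerPow (cwTensor ℂ 2) N) :=
    Literature.Barriers.MatrixMultiplication.asymptoticRank_le_of_polyDegeneratesTo
      h.polyDegeneratesTo
  exact h1.trans (h2.trans (asymptoticRank_cwTwoPow_le N))

/-- **Capacity via rank for DEGENERATIONS** `⟨m,m,m⟩ ⊴ cw₂^{⊠N}` (BCS (15.19)): the same bound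
`m^ω ≤ R̃(cw₂)^N` (a universal spectral point attaining `R̃⟨m,m,m⟩` — Strassen duality, tree
`strassen_duality_asymptoticRank_holds` — is degeneration-monotone, tree
`IsUniversalSpectralPoint.mono_of_algDegeneratesTo`). [cite: Strassen1988, §3, Thm. 3.8] -/
theorem capacityViaRank_of_algDegeneratesTo (N m : ℕ)
    (h : AlgDegeneratesTo (kroneckerPow (cwTensor ℂ 2) N) (matMulTensor ℂ m m m)) :
    (m : ℝ) ^ omega ℂ ≤ asymptoticRank (cwTensor ℂ 2) ^ N := by
  have h1 : (m : ℝ) ^ omega ℂ ≤ asymptoticRank (matMulTensor ℂ m m m) :=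
    rpow_omega_le_asymptoticRank_matMulTensor ℂ m
  have h2 : asymptoticRank (matMulTensor ℂ m m m) ≤
      asymptoticRank (kroneckerPow (cwTensor ℂ 2) N) := by
    obtain ⟨F, hF, hFt⟩ := (strassen_duality_asymptoticRank_holds ℂ (matMulTensor ℂ m m m)).2
    rw [← hFt]
    exact (hF.mono_of_algDegeneratesTo h).trans
      ((strassen_duality_asymptoticRank_holds ℂ (kroneckerPow (cwTensor ℂ 2) N)).1 F hF)
  exact h1.trans (h2.trans (asymptoticRank_cwTwoPow_le N))

/-- **RATE form of the capacity law (restriction):** a cell `⟨m,m,m⟩ ≤ cw₂^{⊠N}` has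
`m² ≤ (R̃(cw₂)^{2/ω})^N`. [cite: Strassen1988, §1] -/
theorem rate_le_of_restrictsTo {N m : ℕ}
    (h : TensorRestrictsTo (kroneckerPow (cwTensor ℂ 2) N) (matMulTensor ℂ m m m)) :
    (m : ℝ) ^ 2 ≤ (asymptoticRank (cwTensor ℂ 2) ^ (2 / omega ℂ)) ^ N := by
  have hω : 2 ≤ omega ℂ := omega_two_le ℂ
  have hωpos : 0 < omega ℂ := by linarith
  have hR0 : 0 ≤ asymptoticRank (cwTensor ℂ 2) := asymptoticRank_nonneg _
  have hm0 : (0 : ℝ) ≤ m := Nat.cast_nonneg m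
  have key := stub_capacityViaRank N m h
  -- raise both sides to the power `2/ω`
  have h2 := Real.rpow_le_rpow (Real.rpow_nonneg hm0 _) key
    (by positivity : (0 : ℝ) ≤ 2 / omega ℂ)
  have lhs : ((m : ℝ) ^ omega ℂ) ^ (2 / omega ℂ) = (m : ℝ) ^ 2 := by
    rw [← Real.rpow_mul hm0, show omega ℂ * (2 / omega ℂ) = (2 : ℕ) by field_simp; ring,
      Real.rpow_natCast]
  have rhs : (asymptoticRank (cwTensor ℂ 2) ^ N) ^ (2 / omega ℂ) =
      (asymptoticRank (cwTensor ℂ 2) ^ (2 / omega ℂ)) ^ N := by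
    rw [← Real.rpow_natCast, ← Real.rpow_mul hR0, mul_comm, Real.rpow_mul hR0, Real.rpow_natCast]
  rwa [lhs, rhs] at h2

/-- **RATE form of the capacity law (degeneration):** a cell `⟨m,m,m⟩ ⊴ cw₂^{⊠N}` has
`m² ≤ (R̃(cw₂)^{2/ω})^N`. [cite: Strassen1988, §3] -/
theorem rate_le_of_algDegeneratesTo {N m : ℕ}
    (h : AlgDegeneratesTo (kroneckerPow (cwTensor ℂ 2) N) (matMulTensor ℂ m m m)) :
    (m : ℝ) ^ 2 ≤ (asymptoticRank (cwTensor ℂ 2) ^ (2 / omega ℂ)) ^ N := by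
  have hω : 2 ≤ omega ℂ := omega_two_le ℂ
  have hωpos : 0 < omega ℂ := by linarith
  have hR0 : 0 ≤ asymptoticRank (cwTensor ℂ 2) := asymptoticRank_nonneg _
  have hm0 : (0 : ℝ) ≤ m := Nat.cast_nonneg m
  have key := capacityViaRank_of_algDegeneratesTo N m h
  have h2 := Real.rpow_le_rpow (Real.rpow_nonneg hm0 _) key
    (by positivity : (0 : ℝ) ≤ 2 / omega ℂ)
  have lhs : ((m : ℝ) ^ omega ℂ) ^ (2 / omega ℂ) = (m : ℝ) ^ 2 := by
    rw [← Real.rpow_mul hm0, show omega ℂ * (2 / omega ℂ) = (2 : ℕ) by field_simp; ring,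
      Real.rpow_natCast]
  have rhs : (asymptoticRank (cwTensor ℂ 2) ^ N) ^ (2 / omega ℂ) =
      (asymptoticRank (cwTensor ℂ 2) ^ (2 / omega ℂ)) ^ N := by
    rw [← Real.rpow_natCast, ← Real.rpow_mul hR0, mul_comm, Real.rpow_mul hR0, Real.rpow_natCast]
  rwa [lhs, rhs] at h2

end Summit.MatrixMultiplication.MatrixMultiplication.Theorems.OutsiderSandwichCapacityViaRank

end
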